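import Literature.AlgebraicGeometry.Motives.MumfordTateRankThree
import Literature.AlgebraicGeometry.Motives.ComparisonAbsoluteProofs
import HarnessLib

/-!
# The Lie algebra of the Hodge group inside the Mumford–Tate Lie algebra: `dim MT(H) ≥ dim Hg(H) + 1`, and
# `dim Hg(H) ≥ 3` as soon as `Lie Hg(H)` contains a non-Hodge endomorphism

Family `hodge`, layer `Literature/AlgebraicGeometry/Motives`; THEOREMS ONLY (no definition, no named fact;
D-0026).  Written for the cell `pub-hodgecm2` (COR-CM) lane MT-RANK-FOUR (the rung `dim MT(H¹(X)) = 4` of the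
Mumford–Tate rank ladder WITHOUT a CM hypothesis), whose abstract heart compares the two rational Lie algebras the
tree attaches to a pure `ℚ`-Hodge structure `H` of weight `n` on a finite-dimensional `V`:

* `𝔥 = H.hodgeLie = Lie Hg(H)` (`Motives/ZarhinHodgeGroupLieAlgebra`: the annihilator of ALL Hodge tensors of all
  types `(p,p)`; `𝔥_ℂ = H.hodgeLieC` its complexification), and
* `𝔪𝔱 = H.mumfordTateLieAlgebra = Lie MT(H)` (`Motives/AtypicalHodgeLocus`: the annihilator of the weight-`0` Hodge
  tensors; `dim_ℚ 𝔪𝔱 = H.mtRank = dim MT(H)`), with `End_Hdg(V) = H.endAlg`.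

Proved here:

* §1 `finrank_span_baseChange_image` — for every rational subspace `W ⊆ End_ℚ V`, `dim_ℂ span_ℂ {X_ℂ | X ∈ W} =
  dim_ℚ W` (extension of scalars `ℂ ⊗ End_ℚ V ≃ End_ℂ V_ℂ`); hence `finrank_hodgeLieC` (`dim_ℂ 𝔥_ℂ = dim_ℚ 𝔥`) and
  `finrank_span_baseChange_mumfordTateLieAlgebra_eq_mtRank` (`dim_ℂ 𝔪𝔱_ℂ = dim MT(H)`, sharpening the `≤` of
  `Motives/MumfordTateLieAlgebraWeights`).
* §2 `hodgeLie_le_mumfordTateLieAlgebra` (`𝔥 ⊆ 𝔪𝔱`); **`id_notMem_hodgeLie`** — for a POLARIZABLE non-zero `H` the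
  homothety `id` is not in `𝔥` (`𝔥 ⊆ 𝔰𝔬(ψ)` by `form_apply_add_eq_zero_of_mem_hodgeLie`, and `ψ_ℂ(x, x̄) ≠ 0` on a
  non-zero Hodge vector by the second Hodge–Riemann relation); hence **`finrank_hodgeLie_add_one_le_mtRank`:
  `dim Hg(H) + 1 ≤ dim MT(H)`** for polarizable `H` of weight `n ≠ 0` (Deligne I 3.4 / Moonen–Zarhin §2:
  `MT = 𝔾ₘ · Hg`; here only the inequality the consumer needs).  `mumfordTateLieAlgebra_le_endAlg_of_hodgeLie_le`,
  `hodgeLie_le_endAlg_iff` — `𝔥 ⊆ End_Hdg(V)` iff `𝔪𝔱 ⊆ End_Hdg(V)` (the CM criterion of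
  `Motives/MumfordTateRankThree` §7 in the `Lie Hg` spelling).
* §3 **`three_le_finrank_hodgeLie_of_not_mem_endAlg` — if some `X ∈ 𝔥` is NOT a Hodge endomorphism then
  `dim Hg(H) ≥ 3`**: the infinitesimal Hodge operator `Θ' = 2Θ − n` (`Θ` the grading operator of a graded basis),
  `[Θ, X_ℂ]` and `[Θ, [Θ, X_ℂ]]` are linearly independent elements of `𝔥_ℂ` (same weight bookkeeping as
  `four_le_mtRank_of_not_mem_endAlg`: a relation kills every root component of `X_ℂ` of non-zero weight except at
  most one weight `k₀`, then weight `−k₀` vanishes, hence `k₀` by the conjugation symmetry of a rational operator).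
  Corollaries `hodgeLie_le_endAlg_of_finrank_hodgeLie_le_two`, `four_le_mtRank_of_not_hodgeLie_le_endAlg`.

This is the Lie-algebra shadow of «`X` is of CM type iff `Hg(X)` is commutative (a torus)» (Moonen–Zarhin 1999 §2,
Deligne I §5) in the form: a Hodge group which is not a torus has dimension `≥ 3` (its semisimple part contains an
`𝔰𝔩₂`); the proofs use neither reductivity nor the structure theory of semisimple Lie algebras.

## References

* [Deligne1982HodgeCycles] P. Deligne, *Hodge cycles on abelian varieties*, LNM 900 (1982), I §3 (3.1–3.4, proof
  of Prop. 3.4: `μ(𝔾ₘ) ⊆ MT_ℂ`, `h(U(1)) ⊆ Hg_ℝ`), §5 Prop. 5.1.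
* [MoonenZarhin1999LowDim] B. Moonen, Yu. Zarhin, *Hodge classes on abelian varieties of low dimension*, Math. Ann.
  315 (1999), §2 (Hodge group, `MT = 𝔾ₘ · Hg`; `X` of CM type iff `Hg(X)` is commutative).
* [Huybrechts2016K3] D. Huybrechts, *Lectures on K3 Surfaces* (2016), §3.3.4 (p. 66), Thm. 3.3.9 (`Hg ⊆ SO(ψ)`,
  the commutant of `Hg`).
* [GreenGriffithsKerr2012] M. Green, P. Griffiths, M. Kerr, *Mumford–Tate Groups and Domains* (2012), I.B and Ch. V
  (V.2)–(V.3).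
-/

noncomputable section

open scoped TensorProduct

namespace Literature.AlgebraicGeometry.Motives

universe u

namespace HodgeStructure

variable {V : Type u} [AddCommGroup V] [Module ℚ V] [Module.Finite ℚ V] [HodgeTensorFacts.{u, u}] {n : ℤ}

/-! ## §1 Complex spans of rational spaces of endomorphisms -/

omit [HodgeTensorFacts.{u, u}] in
/-- **`dim_ℂ span_ℂ {X_ℂ | X ∈ W} = dim_ℚ W`** for a rational subspace `W ⊆ End_ℚ V`: the complex span of the base
changes is the image of `W ⊗ ℂ` under the comparison `ℂ ⊗ End_ℚ V ≃ End_ℂ V_ℂ` (`endBaseChangeEquiv`).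
[cite: Deligne1982HodgeCycles, I §3 (proof of Prop. 3.4)] -/
theorem finrank_span_baseChange_image (W : Submodule ℚ (Module.End ℚ V)) :
    Module.finrank ℂ (Submodule.span ℂ
      ((fun X : Module.End ℚ V => X.baseChange ℂ) '' (W : Set (Module.End ℚ V)))) = Module.finrank ℚ W := by
  have hfun : (⇑(endBaseChangeEquiv V).toLinearMap ∘ ⇑(TensorProduct.mk ℚ ℂ (Module.End ℚ V) 1)) =
      fun X : Module.End ℚ V => X.baseChange ℂ := by
    funext X
    simp [endBaseChangeEquiv_tmul]
  have key : Submodule.span ℂ ((fun X : Module.End ℚ V => X.baseChange ℂ) '' (W : Set (Module.End ℚ V))) =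
      (W.baseChange ℂ).map (endBaseChangeEquiv V).toLinearMap := by
    rw [Submodule.baseChange_eq_span, Submodule.map_span, Submodule.map_coe, ← Set.image_comp, hfun]
  rw [key, LinearEquiv.finrank_map_eq, finrank_submodule_baseChange]

/-- **`dim_ℂ 𝔥_ℂ = dim_ℚ 𝔥 = dim Hg(H)`.** [cite: Huybrechts2016K3, §3.3.4 (p. 66)] -/
theorem finrank_hodgeLieC (H : HodgeStructure V n) :
    Module.finrank ℂ H.hodgeLieC = Module.finrank ℚ H.hodgeLie := by
  unfold hodgeLieC
  exact finrank_span_baseChange_image H.hodgeLie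

/-- **`dim_ℂ 𝔪𝔱_ℂ = dim_ℚ 𝔪𝔱 = dim MT(H)`** (equality; `Motives/MumfordTateLieAlgebraWeights` has `≤`).
[cite: Deligne1982HodgeCycles, I Prop. 3.4] -/
theorem finrank_span_baseChange_mumfordTateLieAlgebra_eq_mtRank (H : HodgeStructure V n) :
    Module.finrank ℂ (Submodule.span ℂ
      ((fun X : Module.End ℚ V => X.baseChange ℂ) '' (H.mumfordTateLieAlgebra : Set (Module.End ℚ V)))) =
      H.mtRank :=
  finrank_span_baseChange_image H.mumfordTateLieAlgebra

/-! ## §2 `Lie Hg ⊆ Lie MT`, the homotheties are not in `Lie Hg`, and `dim Hg + 1 ≤ dim MT` -/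

/-- `𝔥 ⊆ 𝔪𝔱`: `Lie Hg(H) ⊆ Lie MT(H)` (the tree's `hodgeLie_le_lieStabilizer` in the `mumfordTateLieAlgebra`
spelling). [cite: Deligne1982HodgeCycles, I Prop. 3.4] -/
theorem hodgeLie_le_mumfordTateLieAlgebra (H : HodgeStructure V n) : H.hodgeLie ≤ H.mumfordTateLieAlgebra := by
  rw [mumfordTateLieAlgebra_eq_lieStabilizer]
  exact hodgeLie_le_lieStabilizer H

omit [HodgeTensorFacts.{u, u}] in
/-- The complexification of a non-zero finite-dimensional `ℚ`-space is non-zero. [folklore] -/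
private theorem nontrivial_baseChange [Nontrivial V] : Nontrivial (ℂ ⊗[ℚ] V) := by
  apply Module.nontrivial_of_finrank_pos (R := ℂ)
  rw [Module.finrank_baseChange]
  exact Module.finrank_pos

/-- **The homotheties are not in `Lie Hg`** for a polarizable non-zero Hodge structure: `𝔥 ⊆ 𝔰𝔬(ψ)`
(`form_apply_add_eq_zero_of_mem_hodgeLie`), so `id ∈ 𝔥` would give `2 ψ_ℂ(x, x̄) = 0` for every `x`, contradicting
the second Hodge–Riemann relation on a non-zero vector of a Hodge piece.  (Group level: `Hg ⊆ SL(V)`, Moonen–Zarhin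
§2.) [cite: MoonenZarhin1999LowDim, §2] [cite: Huybrechts2016K3, Thm. 3.3.9 (proof, p. 67)] -/
theorem id_notMem_hodgeLie [Nontrivial V] (H : HodgeStructure V n) (ψ : H.Polarization) :
    LinearMap.id ∉ H.hodgeLie := by
  intro hid
  obtain ⟨S, deg, e, hF, hFc⟩ := exists_basis_F_eq_span H
  haveI : Nontrivial (ℂ ⊗[ℚ] V) := nontrivial_baseChange
  obtain ⟨σ⟩ := e.index_nonempty
  have hx : e σ ∈ H.piece (deg σ) (n - deg σ) := basis_mem_piece_of_graded H e hF hFc σ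
  obtain ⟨r, hr, hre⟩ := ψ.pos (deg σ) (n - deg σ) (by ring) (e σ) hx (e.ne_zero σ)
  have hskew := formBaseChange_skew_of_mem_hodgeLieC ψ (H.baseChange_mem_hodgeLieC hid) (e σ) (conj (e σ))
  rw [LinearMap.baseChange_id] at hskew
  simp only [LinearMap.id_apply] at hskew
  have h0 : ψ.form.baseChange ℂ (e σ) (conj (e σ)) = 0 := by linear_combination hskew / 2
  rw [h0, mul_zero] at hre
  have hr0 : (r : ℂ) = 0 := hre.symm
  exact hr.ne' (by exact_mod_cast hr0)

/-- **`dim Hg(H) + 1 ≤ dim MT(H)`** for a polarizable non-zero Hodge structure of weight `n ≠ 0`: `𝔥 ⊕ ℚ·id ⊆ 𝔪𝔱`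
(`id ∈ 𝔪𝔱` as `n ≠ 0`, `id ∉ 𝔥`).  (In fact `MT = 𝔾ₘ · Hg`, Deligne I 3.4 / Moonen–Zarhin §2; only the inequality is
recorded.) [cite: MoonenZarhin1999LowDim, §2] [cite: Deligne1982HodgeCycles, I Prop. 3.4] -/
theorem finrank_hodgeLie_add_one_le_mtRank [Nontrivial V] (H : HodgeStructure V n) (ψ : H.Polarization)
    (hn : n ≠ 0) : Module.finrank ℚ H.hodgeLie + 1 ≤ H.mtRank := by
  set L : Submodule ℚ (Module.End ℚ V) := ℚ ∙ (LinearMap.id : Module.End ℚ V) with hL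
  have hid0 : (LinearMap.id : Module.End ℚ V) ≠ 0 := one_ne_zero
  have hinf : H.hodgeLie ⊓ L = ⊥ := by
    rw [Submodule.eq_bot_iff]
    intro X hX
    obtain ⟨hX1, hX2⟩ := Submodule.mem_inf.1 hX
    obtain ⟨c, rfl⟩ := Submodule.mem_span_singleton.1 hX2
    by_cases hc : c = 0
    · rw [hc, zero_smul]
    · exfalso
      apply id_notMem_hodgeLie H ψ
      have h := H.hodgeLie.smul_mem c⁻¹ hX1
      rwa [smul_smul, inv_mul_cancel₀ hc, one_smul] at h
  have hsup : H.hodgeLie ⊔ L ≤ H.mumfordTateLieAlgebra :=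
    sup_le (hodgeLie_le_mumfordTateLieAlgebra H)
      ((Submodule.span_singleton_le_iff_mem _ _).2 (H.id_mem_mumfordTateLieAlgebra hn))
  have hdim := Submodule.finrank_sup_add_finrank_inf_eq H.hodgeLie L
  rw [hinf, finrank_bot, add_zero, hL, finrank_span_singleton hid0] at hdim
  calc Module.finrank ℚ H.hodgeLie + 1
      = Module.finrank ℚ ↥(H.hodgeLie ⊔ ℚ ∙ (LinearMap.id : Module.End ℚ V)) := hdim.symm
    _ ≤ Module.finrank ℚ H.mumfordTateLieAlgebra := Submodule.finrank_mono hsup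
    _ = H.mtRank := rfl

/-- **If `Lie Hg ⊆ End_Hdg(V)` then `Lie MT ⊆ End_Hdg(V)`**: every `X ∈ 𝔪𝔱` commutes with `End_Hdg(V) ⊇ 𝔥`
(`commute_of_mem_mumfordTateLieAlgebra`), and the commutant of `𝔥` is `End_Hdg(V)` (`mem_endAlg_of_forall_commute`,
`Θ ∈ 𝔥_ℂ`). [cite: Huybrechts2016K3, §3.3.4 (p. 66)] [cite: Deligne1982HodgeCycles, I Prop. 3.4] -/
theorem mumfordTateLieAlgebra_le_endAlg_of_hodgeLie_le (H : HodgeStructure V n)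
    (hle : H.hodgeLie ≤ Subalgebra.toSubmodule H.endAlg) :
    H.mumfordTateLieAlgebra ≤ Subalgebra.toSubmodule H.endAlg := by
  intro X hX
  rw [Subalgebra.mem_toSubmodule]
  exact H.mem_endAlg_of_forall_commute fun Y hY => commute_of_mem_mumfordTateLieAlgebra H hX (hle hY)

/-- **`Lie Hg ⊆ End_Hdg(V)` iff `Lie MT ⊆ End_Hdg(V)`** (iff `𝔪𝔱` is abelian, `mumfordTateLieAlgebra_le_endAlg_iff_comm`;
on `H¹` of an abelian variety: iff CM type). [cite: MoonenZarhin1999LowDim, §2] [cite: GreenGriffithsKerr2012, Ch. V (V.2)–(V.3)] -/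
theorem hodgeLie_le_endAlg_iff (H : HodgeStructure V n) :
    H.hodgeLie ≤ Subalgebra.toSubmodule H.endAlg ↔ H.mumfordTateLieAlgebra ≤ Subalgebra.toSubmodule H.endAlg :=
  ⟨mumfordTateLieAlgebra_le_endAlg_of_hodgeLie_le H,
    fun h => (hodgeLie_le_mumfordTateLieAlgebra H).trans h⟩

/-! ## §3 `Lie Hg ⊄ End_Hdg(V)` forces `dim Hg ≥ 3` -/

section Graded

variable {S : Type u} [Fintype S] [DecidableEq S] {deg : S → ℤ}

/-- **The infinitesimal Hodge operator `Θ' = 2Θ − n` lies in `𝔥_ℂ`** (`Θ = gradingEnd e deg` the grading operator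
of a graded basis adapted to `H`; `Θ'` acts on `V^{p,n-p}` by `2p − n`, `mem_hodgeLieC_of_forall_piece`: Deligne I 3.4,
`h(U(1)) ⊆ Hg_ℝ`). [cite: Deligne1982HodgeCycles, I §3 (3.1–3.4)] [cite: Huybrechts2016K3, §3.3.4 (p. 66)] -/
theorem two_smul_gradingEnd_sub_mem_hodgeLieC (H : HodgeStructure V n) (e : Module.Basis S ℂ (ℂ ⊗[ℚ] V))
    (hF : ∀ a, H.F a = Submodule.span ℂ (e '' {σ | a ≤ deg σ}))
    (hFc : ∀ a, complexConj (H.F a) = Submodule.span ℂ (e '' {σ | deg σ ≤ n - a})) :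
    (2 : ℂ) • gradingEnd e deg - (n : ℂ) • (1 : Module.End ℂ (ℂ ⊗[ℚ] V)) ∈ H.hodgeLieC := by
  have hdiag : ∀ σ, ((2 : ℂ) • gradingEnd e deg - (n : ℂ) • (1 : Module.End ℂ (ℂ ⊗[ℚ] V))) (e σ) =
      (fun d : ℤ => ((2 * d - n : ℤ) : ℂ)) (deg σ) • e σ := by
    intro σ
    rw [LinearMap.sub_apply, LinearMap.smul_apply, LinearMap.smul_apply, gradingEnd_apply_basis,
      Module.End.one_apply, smul_smul, ← sub_smul]
    congr 1
    push_cast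
    ring
  refine H.mem_hodgeLieC_of_forall_piece fun p x hx => ?_
  exact apply_eq_smul_of_mem_piece_of_graded H e hF hFc _ (f := fun d : ℤ => ((2 * d - n : ℤ) : ℂ)) hdiag p hx

/-- **`[Θ, Y] ∈ 𝔥_ℂ` for `Y ∈ 𝔥_ℂ`** (`Θ` the grading operator): `[Θ, Y] = ½ [Θ', Y]` with `Θ' = 2Θ − n ∈ 𝔥_ℂ`, and
`𝔥_ℂ` is a Lie algebra. [cite: Deligne1982HodgeCycles, I §3 (proof of Prop. 3.4)] -/
theorem commutator_gradingEnd_mem_hodgeLieC (H : HodgeStructure V n) (e : Module.Basis S ℂ (ℂ ⊗[ℚ] V))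
    (hF : ∀ a, H.F a = Submodule.span ℂ (e '' {σ | a ≤ deg σ}))
    (hFc : ∀ a, complexConj (H.F a) = Submodule.span ℂ (e '' {σ | deg σ ≤ n - a}))
    {Y : Module.End ℂ (ℂ ⊗[ℚ] V)} (hY : Y ∈ H.hodgeLieC) :
    gradingEnd e deg * Y - Y * gradingEnd e deg ∈ H.hodgeLieC := by
  have h := H.commutator_mem_hodgeLieC (two_smul_gradingEnd_sub_mem_hodgeLieC H e hF hFc) hY
  have hcomm : ((2 : ℂ) • gradingEnd e deg - (n : ℂ) • (1 : Module.End ℂ (ℂ ⊗[ℚ] V))) * Y -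
      Y * ((2 : ℂ) • gradingEnd e deg - (n : ℂ) • 1) = (2 : ℂ) • (gradingEnd e deg * Y - Y * gradingEnd e deg) := by
    rw [sub_mul, mul_sub, smul_mul_assoc, smul_mul_assoc, mul_smul_comm, mul_smul_comm, one_mul, mul_one, smul_sub]
    abel
  rw [hcomm] at h
  have h' := H.hodgeLieC.smul_mem (2 : ℂ)⁻¹ h
  rwa [smul_smul, inv_mul_cancel₀ (two_ne_zero : (2 : ℂ) ≠ 0), one_smul] at h'

end Graded

/-- **If some `X ∈ Lie Hg` is not a Hodge endomorphism then `dim Hg(H) ≥ 3`.**  In a graded basis adapted to `H`,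
`X_ℂ` has a non-zero entry of some weight `k ≠ 0`; the three elements `Θ' = 2Θ − n`, `Z = [Θ, X_ℂ]`, `Z' = [Θ, Z]` of
`𝔥_ℂ` are linearly independent, whence `3 ≤ dim_ℂ 𝔥_ℂ = dim_ℚ 𝔥`: a relation `β Θ' + γ Z + δ Z' = 0` reads
`β (2 deg τ − n) = 0` on the diagonal (so `β = 0`: two distinct degrees occur, one of them `≠ n/2`) and
`(γ + δ m) (X_ℂ)_{στ} = 0` off it, `m = deg σ − deg τ ≠ 0`; so `γ + δ k = 0`, `γ − δ k ≠ 0`, all entries of weight `−k`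
vanish, hence (conjugation symmetry, `X` rational) all entries of weight `k` — a contradiction.  Group level: a Hodge
group which is not a torus has a semisimple part of dimension `≥ 3`. [cite: MoonenZarhin1999LowDim, §2]
[cite: Deligne1982HodgeCycles, I Prop. 3.4 (proof) and §5] -/
theorem three_le_finrank_hodgeLie_of_not_mem_endAlg (H : HodgeStructure V n) {X : Module.End ℚ V}
    (hX : X ∈ H.hodgeLie) (hXE : X ∉ H.endAlg) : 3 ≤ Module.finrank ℚ H.hodgeLie := by
  classical
  obtain ⟨S, deg, e, hF, hFc⟩ := exists_basis_F_eq_span H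
  haveI : Fintype S := FiniteDimensional.fintypeBasisIndex e
  -- a non-zero entry of non-zero weight
  obtain ⟨σ₀, τ₀, hdeg, hE⟩ : ∃ σ τ : S, deg σ ≠ deg τ ∧ e.repr (X.baseChange ℂ (e τ)) σ ≠ 0 := by
    by_contra hcon
    push Not at hcon
    exact hXE (mem_endAlg_of_repr_baseChange_eq_zero H e hF fun σ τ hστ => hcon σ τ hστ)
  set M : Submodule ℂ (Module.End ℂ (ℂ ⊗[ℚ] V)) := H.hodgeLieC with hM
  set Θ : Module.End ℂ (ℂ ⊗[ℚ] V) := gradingEnd e deg with hΘ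
  set Θ' : Module.End ℂ (ℂ ⊗[ℚ] V) := (2 : ℂ) • Θ - (n : ℂ) • 1 with hΘ'
  set Y : Module.End ℂ (ℂ ⊗[ℚ] V) := X.baseChange ℂ with hY
  set Z : Module.End ℂ (ℂ ⊗[ℚ] V) := Θ * Y - Y * Θ with hZ
  set Z' : Module.End ℂ (ℂ ⊗[ℚ] V) := Θ * Z - Z * Θ with hZ'
  -- the three elements of `𝔥_ℂ`
  have hΘ'M : Θ' ∈ M := two_smul_gradingEnd_sub_mem_hodgeLieC H e hF hFc
  have hYM : Y ∈ M := H.baseChange_mem_hodgeLieC hX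
  have hZM : Z ∈ M := commutator_gradingEnd_mem_hodgeLieC H e hF hFc hYM
  have hZ'M : Z' ∈ M := commutator_gradingEnd_mem_hodgeLieC H e hF hFc hZM
  let v : Fin 3 → Module.End ℂ (ℂ ⊗[ℚ] V) := ![Θ', Z, Z']
  have hv : ∀ i, v i ∈ M := by
    intro i
    fin_cases i
    · exact hΘ'M
    · exact hZM
    · exact hZ'M
  by_cases hli : LinearIndependent ℂ v
  · -- `3 ≤ dim_ℂ 𝔥_ℂ = dim_ℚ 𝔥`
    have hli' : LinearIndependent ℂ (fun i => (⟨v i, hv i⟩ : M)) :=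
      LinearIndependent.of_comp M.subtype (by exact hli)
    have h3 : 3 ≤ Module.finrank ℂ M := by
      have h := hli'.fintype_card_le_finrank
      rwa [Fintype.card_fin] at h
    rw [← finrank_hodgeLieC]
    exact h3
  · exfalso
    obtain ⟨g, hg, i₀, hi₀⟩ := Fintype.not_linearIndependent_iff.1 hli
    have hg' : g 0 • Θ' + g 1 • Z + g 2 • Z' = 0 := by
      simpa [Fin.sum_univ_three, v] using hg
    -- the entries of `Θ'`
    have hΘ'e : ∀ σ τ : S, e.repr (Θ' (e τ)) σ = (2 * (deg τ : ℂ) - n) * Finsupp.single τ (1 : ℂ) σ := by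
      intro σ τ
      simp only [hΘ', LinearMap.sub_apply, LinearMap.smul_apply, hΘ, gradingEnd_apply_basis, Module.End.one_apply,
        map_sub, map_smul, Module.Basis.repr_self, Finsupp.coe_sub, Finsupp.coe_smul, Pi.sub_apply, Pi.smul_apply,
        smul_eq_mul]
      ring
    -- the entries of the relation
    have hentry : ∀ σ τ : S,
        g 0 * ((2 * (deg τ : ℂ) - n) * Finsupp.single τ (1 : ℂ) σ) +
          g 1 * (((deg σ : ℂ) - deg τ) * e.repr (Y (e τ)) σ) +
          g 2 * (((deg σ : ℂ) - deg τ) * (((deg σ : ℂ) - deg τ) * e.repr (Y (e τ)) σ)) = 0 := by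
      intro σ τ
      have h := congrArg (fun T : Module.End ℂ (ℂ ⊗[ℚ] V) => e.repr (T (e τ)) σ) hg'
      simp only [LinearMap.add_apply, LinearMap.smul_apply, LinearMap.zero_apply, map_add, map_smul, map_zero,
        Finsupp.coe_add, Finsupp.coe_smul, Finsupp.coe_zero, Pi.add_apply, Pi.smul_apply, Pi.zero_apply,
        smul_eq_mul, hZ', hZ, hΘ, repr_commutator_gradingEnd_apply_basis, hΘ'e] at h
      exact h
    -- diagonal entries: `g 0 * (2 deg τ - n) = 0`
    have hdiag : ∀ τ : S, g 0 * (2 * (deg τ : ℂ) - n) = 0 := by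
      intro τ
      have h := hentry τ τ
      simp only [Finsupp.single_eq_same, sub_self, zero_mul, mul_zero, add_zero, mul_one] at h
      exact h
    have hg0 : g 0 = 0 := by
      -- one of `deg σ₀`, `deg τ₀` is not `n / 2`
      by_cases hσ : 2 * (deg σ₀ : ℂ) - n = 0
      · have hτ : 2 * (deg τ₀ : ℂ) - n ≠ 0 := by
          intro hτ
          apply hdeg
          have h2 : (2 : ℂ) * ((deg σ₀ : ℂ) - deg τ₀) = 0 := by linear_combination hσ - hτ
          have h3 : ((deg σ₀ : ℂ) - deg τ₀) = 0 := (mul_eq_zero.1 h2).resolve_left two_ne_zero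
          exact Int.cast_injective (sub_eq_zero.1 h3)
        exact (mul_eq_zero.1 (hdiag τ₀)).resolve_right hτ
      · exact (mul_eq_zero.1 (hdiag σ₀)).resolve_right hσ
    -- off-diagonal entries: `(g 1 + g 2 * m) * Y_{στ} = 0` for `m = deg σ - deg τ ≠ 0`
    have hoff : ∀ σ τ : S, deg σ ≠ deg τ →
        (g 1 + g 2 * ((deg σ : ℂ) - deg τ)) * e.repr (Y (e τ)) σ = 0 := by
      intro σ τ hστ
      have hne : σ ≠ τ := fun h => hστ (by rw [h])
      have hm : ((deg σ : ℂ) - deg τ) ≠ 0 := sub_ne_zero.2 fun h => hστ (Int.cast_injective h)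
      have h := hentry σ τ
      rw [Finsupp.single_eq_of_ne hne, mul_zero, mul_zero, zero_add] at h
      have h' : ((deg σ : ℂ) - deg τ) * ((g 1 + g 2 * ((deg σ : ℂ) - deg τ)) * e.repr (Y (e τ)) σ) = 0 := by
        linear_combination h
      exact (mul_eq_zero.1 h').resolve_left hm
    -- the weight `k = deg σ₀ - deg τ₀` of the non-zero entry: `g 1 + g 2 * k = 0`
    set k : ℂ := (deg σ₀ : ℂ) - deg τ₀ with hk
    have hk0 : k ≠ 0 := sub_ne_zero.2 fun h => hdeg (Int.cast_injective h)
    have hgk : g 1 + g 2 * k = 0 := by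
      rcases mul_eq_zero.1 (hoff σ₀ τ₀ hdeg) with h | h
      · exact h
      · exact absurd h hE
    have hgk' : g 1 + g 2 * (-k) ≠ 0 := by
      intro h
      have hg1 : g 1 = 0 := by linear_combination (h + hgk) / 2
      have hg2 : g 2 = 0 := by
        have h3 : g 2 * k = 0 := by linear_combination hgk - hg1
        exact (mul_eq_zero.1 h3).resolve_right hk0
      apply hi₀
      fin_cases i₀
      · exact hg0
      · exact hg1
      · exact hg2
    -- all entries of weight `-k` vanish, hence (conjugation) all entries of weight `k`: contradiction
    have hneg : ∀ σ τ : S, deg σ - deg τ = -(deg σ₀ - deg τ₀) → e.repr (Y (e τ)) σ = 0 := by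
      intro σ τ hστ
      have hστ' : deg σ ≠ deg τ := by
        intro h
        rw [h, sub_self] at hστ
        exact hdeg (by omega)
      have hcast : ((deg σ : ℂ) - deg τ) = -k := by
        rw [hk]
        exact_mod_cast hστ
      have h := hoff σ τ hστ'
      rw [hcast] at h
      exact (mul_eq_zero.1 h).resolve_left hgk'
    exact hE (repr_baseChange_apply_eq_zero_of_neg H e hF hFc X hneg σ₀ τ₀ rfl)

/-- **`dim Hg(H) ≤ 2` ⟹ `Lie Hg ⊆ End_Hdg(V)`** (contrapositive of `three_le_finrank_hodgeLie_of_not_mem_endAlg`); with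
`hodgeLie_le_endAlg_iff`, also `Lie MT ⊆ End_Hdg(V)` — on `H¹` of an abelian variety: `dim Hg(X) ≤ 2` forces CM type.
[cite: MoonenZarhin1999LowDim, §2] -/
theorem hodgeLie_le_endAlg_of_finrank_hodgeLie_le_two (H : HodgeStructure V n)
    (h2 : Module.finrank ℚ H.hodgeLie ≤ 2) : H.hodgeLie ≤ Subalgebra.toSubmodule H.endAlg := by
  intro X hX
  rw [Subalgebra.mem_toSubmodule]
  by_contra hXE
  have h3 := three_le_finrank_hodgeLie_of_not_mem_endAlg H hX hXE
  omega

/-- **If `Lie Hg ⊄ End_Hdg(V)` then `dim Hg(H) ≥ 3` and, for polarizable non-zero `H` of weight `n ≠ 0`,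
`dim MT(H) ≥ 4`** (`dim MT ≥ dim Hg + 1`). [cite: MoonenZarhin1999LowDim, §2] [cite: Deligne1982HodgeCycles, I Prop. 3.4] -/
theorem four_le_mtRank_of_not_hodgeLie_le_endAlg [Nontrivial V] (H : HodgeStructure V n) (ψ : H.Polarization)
    (hn : n ≠ 0) (hne : ¬ H.hodgeLie ≤ Subalgebra.toSubmodule H.endAlg) :
    3 ≤ Module.finrank ℚ H.hodgeLie ∧ 4 ≤ H.mtRank := by
  have h3 : 3 ≤ Module.finrank ℚ H.hodgeLie := by
    by_contra h
    exact hne (hodgeLie_le_endAlg_of_finrank_hodgeLie_le_two H (by omega))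
  exact ⟨h3, le_trans (by omega) (finrank_hodgeLie_add_one_le_mtRank H ψ hn)⟩

end HodgeStructure

end Literature.AlgebraicGeometry.Motives

end
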